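import Summits.Ventures.PercRepro.C041TwoExitZone
import Summits.Ventures.PercRepro.C041SixVec

/-!
# ROW C-041 — THE TWO-EXIT ATTACHMENT, COUNTED: the six anchor classes over the colourings of the multigraph
(p6, gen 31; mine-3's C-041.md §20 (c) BLOCK MAPS with two exits, §21 (b))

Setting of `C041TwoExitZone`: `glue2 Z₁ u u' Z a Z' a'` (the unmarked multigraph `Z₁` with `Z'` hung at `u'` and
`Z` hung at `u`), anchor `inl (inl a₁)`.  A state is a triple — a colouring `ω` of `Z₁`, a state of `Z'`, a state
of `Z` (`stateEquiv`) — and every count of the attachment is a sum over `ω` of a count on pairs of zone states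
(`card_filter_eq`, `card_filter_prod_eq_sum`).  THE ANCHOR CLASSES `(c1, c2, k)` — admissible, not deleted (if
`c1`), not deleted on side `2` (if `c2`), blue at `K` (if `k`); the six counts of the six-vector are
`(T,T,F), (F,T,F), (T,F,F), (T,T,T), (F,T,T), (T,F,T)` — are the conditions `fibCond` on the triple
(`mem_Fset_iff` … `mem_IBset_iff`), and for a FIXED colouring `ω` the count of pairs is read off the statuses of
the exits (`Mg` merged, `Rd` reached, `Mg u u'` blue-connected) through the one-zone classes `cls Z a c1 c2 k r`
(`r` = «the exit is reached»):

* both exits merged — the product of the two classes (`card_fib_merged_merged`);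
* one merged, one separated — the merged exit's class times the other's admissible-or-invalid count
  (`card_fib_merged_sep`, `card_fib_sep_merged`);
* both separated in different sub-zones — the product of the two admissible-or-invalid counts
  (`card_fib_sep_sep`);
* both separated in ONE sub-zone (blue-connected) — the inclusion–exclusion `L₁L₁' + L₂L₂' − L₀L₀'` of the
  joint sub-zone (`card_fib_joint`).

The six-vector form (`contrib`, THEOREM (TWO-EXIT BLOCK MAP)) is the next module.
-/

namespace PercRepro

namespace ZoneZ

namespace TwoExit

open ZoneData Pendant AnchorGlue Finset

variable {V₁ E₁ U₁ U₂ V E T₁ T₂ V' E' T₁' T₂' : Type}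
variable (Z₁ : ZoneData V₁ E₁ U₁ U₂) (u u' : V₁) (Z : ZoneData V E T₁ T₂) (a : V) (Z' : ZoneData V' E' T₁' T₂')
  (a' : V') (a₁ : V₁)

/-! ## The states of the attachment are triples -/

/-- The states of the two-exit attachment: a colouring of `Z₁`, a state of `Z'`, a state of `Z`. -/
def stateEquiv :
    State ((E₁ ⊕ E') ⊕ E) (T₁' ⊕ T₁) (T₂' ⊕ T₂) ≃ (E₁ → Bool) × State E' T₁' T₂' × State E T₁ T₂ where
  toFun σ := (col₁ σ, st' σ, st σ)
  invFun p := (Sum.elim (Sum.elim p.1 p.2.1.1) p.2.2.1, Sum.elim p.2.1.2.1 p.2.2.2.1,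
    Sum.elim p.2.1.2.2 p.2.2.2.2)
  left_inv σ := by
    obtain ⟨c, m₁, m₂⟩ := σ
    refine Prod.ext ?_ (Prod.ext ?_ ?_)
    · funext e
      rcases e with (e | e) | e <;> rfl
    · funext t
      rcases t with t | t <;> rfl
    · funext t
      rcases t with t | t <;> rfl
  right_inv p := by
    obtain ⟨ω, ⟨c', m₁', m₂'⟩, ⟨c, m₁, m₂⟩⟩ := p
    rfl

/-- The equivalence, applied. -/
theorem stateEquiv_apply (σ : State ((E₁ ⊕ E') ⊕ E) (T₁' ⊕ T₁) (T₂' ⊕ T₂)) :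
    stateEquiv σ = (col₁ σ, st' σ, st σ) := rfl

/-! ## The statuses of the two exits -/

/-- Two merged exits are blue-connected. -/
theorem Mg_exits_of_merged (ω : E₁ → Bool) (h : Z₁.Mg a₁ u ω) (h' : Z₁.Mg a₁ u' ω) : Z₁.Mg u u' ω :=
  Mg_trans Z₁ ω u a₁ u' (Mg_symm Z₁ ω a₁ u h) h'

/-- A merged and a separated exit are not blue-connected. -/
theorem not_Mg_exits_of_merged_sep (ω : E₁ → Bool) (h : Z₁.Mg a₁ u ω) (h' : ¬ Z₁.Mg a₁ u' ω) :
    ¬ Z₁.Mg u u' ω :=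
  fun hc => h' (Mg_trans Z₁ ω a₁ u u' h hc)

/-- A separated and a merged exit are not blue-connected. -/
theorem not_Mg_exits_of_sep_merged (ω : E₁ → Bool) (h : ¬ Z₁.Mg a₁ u ω) (h' : Z₁.Mg a₁ u' ω) :
    ¬ Z₁.Mg u u' ω :=
  fun hc => h (Mg_trans Z₁ ω a₁ u' u h' (Mg_symm Z₁ ω u u' hc))

section Counts

variable [Fintype E₁] [DecidableEq E₁] [Fintype E] [DecidableEq E] [Fintype T₁] [DecidableEq T₁]
  [Fintype T₂] [DecidableEq T₂] [Fintype E'] [DecidableEq E'] [Fintype T₁'] [DecidableEq T₁']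
  [Fintype T₂'] [DecidableEq T₂']

/-- A filter on the states of the attachment, as a filter on triples. -/
theorem card_filter_eq (Q : State ((E₁ ⊕ E') ⊕ E) (T₁' ⊕ T₁) (T₂' ⊕ T₂) → Prop)
    (Q' : (E₁ → Bool) × State E' T₁' T₂' × State E T₁ T₂ → Prop) [DecidablePred Q] [DecidablePred Q']
    (h : ∀ σ, Q σ ↔ Q' (col₁ σ, st' σ, st σ)) : #(univ.filter Q) = #(univ.filter Q') := by
  refine Finset.card_equiv (stateEquiv (E₁ := E₁) (E := E) (T₁ := T₁) (T₂ := T₂) (E' := E') (T₁' := T₁')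
    (T₂' := T₂')) fun σ => ?_
  rw [Finset.mem_filter, Finset.mem_filter]
  simp only [Finset.mem_univ, true_and, stateEquiv_apply]
  exact h σ

/-- A count on a product is the sum over the first coordinate of the counts on the fibres. -/
theorem card_filter_prod_eq_sum {α β : Type*} [Fintype α] [Fintype β] (Q : α × β → Prop) [DecidablePred Q] :
    #(univ.filter Q) = ∑ x : α, #(univ.filter fun y : β => Q (x, y)) := by
  rw [Finset.card_filter, Fintype.sum_prod_type]
  simp only [Finset.card_filter]

/-! ## The anchor classes as conditions on the triple -/

/-- The condition on a colouring `ω` of `Z₁` and states `τ'` of `Z'`, `τ` of `Z` for the corresponding state of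
the two-exit attachment to lie in the anchor class `(c1, c2, k)`: admissible; not deleted if `c1`; not deleted on
side `2` if `c2`; blue at `K` if `k` (`C041TwoExitZone`: `adm_iff`, `anchor_mem_D_iff`, `anchor_mem_D2_iff`,
`blueK_iff`). -/
def fibCond (ω : E₁ → Bool) (c1 c2 k : Bool) (τ' : State E' T₁' T₂') (τ : State E T₁ T₂) : Prop :=
  Z'.adm τ' ∧ Z.adm τ ∧
    ¬ (((a' ∈ Z'.D τ' ∧ Z₁.Mg u u' ω) ∨ a ∈ Z.D τ) ∧ ((a' ∈ Z'.D2 τ' ∧ Z₁.Mg u u' ω) ∨ a ∈ Z.D2 τ)) ∧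
    (c1 = true → ¬ ((a' ∈ Z'.D τ' ∧ Z₁.Mg a₁ u' ω) ∨ (a ∈ Z.D τ ∧ Z₁.Mg a₁ u ω))) ∧
    (c2 = true → ¬ ((a' ∈ Z'.D2 τ' ∧ Z₁.Mg a₁ u' ω) ∨ (a ∈ Z.D2 τ ∧ Z₁.Mg a₁ u ω))) ∧
    (k = true → ((Z₁.Rd a₁ u' ω → Z'.blueK {a'} τ') ∧ (Z₁.Rd a₁ u ω → Z.blueK {a} τ)))

variable (σ : State ((E₁ ⊕ E') ⊕ E) (T₁' ⊕ T₁) (T₂' ⊕ T₂))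

/-- `F`: the class `(T, T, F)`. -/
theorem mem_Fset_iff :
    σ ∈ (glue2 Z₁ u u' Z a Z' a').Fset (Sum.inl (Sum.inl a₁)) ↔
      fibCond Z₁ u u' Z a Z' a' a₁ (col₁ σ) true true false (st' σ) (st σ) := by
  rw [mem_Fset, adm_iff, anchor_mem_D_iff, anchor_mem_D2_iff]
  simp only [fibCond, Bool.false_eq_true, false_implies, and_true, true_implies, and_assoc]

/-- `F + T₁`: the class `(F, T, F)`. -/
theorem mem_FAset_iff :
    σ ∈ (glue2 Z₁ u u' Z a Z' a').FAset (Sum.inl (Sum.inl a₁)) ↔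
      fibCond Z₁ u u' Z a Z' a' a₁ (col₁ σ) false true false (st' σ) (st σ) := by
  rw [mem_FAset, adm_iff, anchor_mem_D2_iff]
  simp only [fibCond, Bool.false_eq_true, false_implies, and_true, true_implies, true_and, and_assoc]

/-- `F + T₂`: the class `(T, F, F)`. -/
theorem mem_FBset_iff :
    σ ∈ (glue2 Z₁ u u' Z a Z' a').FBset (Sum.inl (Sum.inl a₁)) ↔
      fibCond Z₁ u u' Z a Z' a' a₁ (col₁ σ) true false false (st' σ) (st σ) := by
  rw [mem_FBset, adm_iff, anchor_mem_D_iff]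
  simp only [fibCond, Bool.false_eq_true, false_implies, and_true, true_implies, and_assoc]

/-- `I_F`: the class `(T, T, T)`. -/
theorem mem_IFset_iff :
    σ ∈ (glue2 Z₁ u u' Z a Z' a').IFset (Sum.inl (Sum.inl a₁)) ↔
      fibCond Z₁ u u' Z a Z' a' a₁ (col₁ σ) true true true (st' σ) (st σ) := by
  rw [mem_IFset, adm_iff, anchor_mem_D_iff, anchor_mem_D2_iff, blueK_iff]
  simp only [fibCond, true_implies, and_assoc]
  tauto

/-- `I_F + I₁`: the class `(F, T, T)`. -/
theorem mem_IAset_iff :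
    σ ∈ (glue2 Z₁ u u' Z a Z' a').IAset (Sum.inl (Sum.inl a₁)) ↔
      fibCond Z₁ u u' Z a Z' a' a₁ (col₁ σ) false true true (st' σ) (st σ) := by
  rw [mem_IAset, adm_iff, anchor_mem_D2_iff, blueK_iff]
  simp only [fibCond, Bool.false_eq_true, false_implies, true_implies, true_and, and_assoc]
  tauto

/-- `I_F + I₂`: the class `(T, F, T)`. -/
theorem mem_IBset_iff :
    σ ∈ (glue2 Z₁ u u' Z a Z' a').IBset (Sum.inl (Sum.inl a₁)) ↔
      fibCond Z₁ u u' Z a Z' a' a₁ (col₁ σ) true false true (st' σ) (st σ) := by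
  rw [mem_IBset, adm_iff, anchor_mem_D_iff, blueK_iff]
  simp only [fibCond, Bool.false_eq_true, false_implies, true_implies, true_and, and_assoc]
  tauto

/-! ## The one-zone classes -/

open Classical in
/-- The one-zone class `(c1, c2, k)` of `Z` at `a` for an exit of reached-status `r`: admissible; `a` not deleted
if `c1`; not deleted on side `2` if `c2`; blue at `K` if `k` and the exit is reached. -/
noncomputable def cls {V E T₁ T₂ : Type} (Z : ZoneData V E T₁ T₂) (a : V) [Fintype E] [Fintype T₁] [Fintype T₂]
    (c1 c2 k : Bool) (r : Prop) : Finset (State E T₁ T₂) :=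
  univ.filter fun τ => Z.adm τ ∧ (c1 = true → a ∉ Z.D τ) ∧ (c2 = true → a ∉ Z.D2 τ) ∧
    (k = true → r → Z.blueK {a} τ)

/-- Membership in a one-zone class. -/
theorem mem_cls {V E T₁ T₂ : Type} (Z : ZoneData V E T₁ T₂) (a : V) [Fintype E] [Fintype T₁] [Fintype T₂]
    (c1 c2 k : Bool) (r : Prop) (τ : State E T₁ T₂) :
    τ ∈ cls Z a c1 c2 k r ↔ Z.adm τ ∧ (c1 = true → a ∉ Z.D τ) ∧ (c2 = true → a ∉ Z.D2 τ) ∧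
      (k = true → r → Z.blueK {a} τ) := by
  classical
  unfold cls
  rw [Finset.mem_filter]
  exact and_iff_right (Finset.mem_univ _)

open Classical in
/-- The fibre of the class `(c1, c2, k)` over the colouring `ω`: the pairs of zone states satisfying `fibCond`. -/
noncomputable def fib (ω : E₁ → Bool) (c1 c2 k : Bool) : Finset (State E' T₁' T₂' × State E T₁ T₂) :=
  univ.filter fun p => fibCond Z₁ u u' Z a Z' a' a₁ ω c1 c2 k p.1 p.2

omit [Fintype E₁] [DecidableEq E₁] in
/-- Membership in a fibre. -/
theorem mem_fib (ω : E₁ → Bool) (c1 c2 k : Bool) (p : State E' T₁' T₂' × State E T₁ T₂) :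
    p ∈ fib Z₁ u u' Z a Z' a' a₁ ω c1 c2 k ↔ fibCond Z₁ u u' Z a Z' a' a₁ ω c1 c2 k p.1 p.2 := by
  classical
  unfold fib
  rw [Finset.mem_filter]
  exact and_iff_right (Finset.mem_univ _)

/-! ## The fibre counts by the statuses -/

omit [Fintype E₁] [DecidableEq E₁] in
/-- **Both exits merged**: the fibre of the class `(c1, c2, k)` (with `c1` or `c2`) is the product of the two
one-zone classes. -/
theorem card_fib_merged_merged (ω : E₁ → Bool) (hm : Z₁.Mg a₁ u ω) (hm' : Z₁.Mg a₁ u' ω) (c1 c2 k : Bool)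
    (hc : c1 = true ∨ c2 = true) :
    #(fib Z₁ u u' Z a Z' a' a₁ ω c1 c2 k) =
      #(cls Z' a' c1 c2 k (Z₁.Rd a₁ u' ω)) * #(cls Z a c1 c2 k (Z₁.Rd a₁ u ω)) := by
  have hbc := Mg_exits_of_merged Z₁ u u' a₁ ω hm hm'
  have e : fib Z₁ u u' Z a Z' a' a₁ ω c1 c2 k =
      cls Z' a' c1 c2 k (Z₁.Rd a₁ u' ω) ×ˢ cls Z a c1 c2 k (Z₁.Rd a₁ u ω) := by
    ext p
    rw [mem_fib, Finset.mem_product, mem_cls, mem_cls]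
    simp only [fibCond, hm, hm', hbc, and_true]
    rcases hc with rfl | rfl <;> simp only [true_implies, not_or] <;> aesop
  rw [e, Finset.card_product]

omit [Fintype E₁] [DecidableEq E₁] in
/-- **`u` merged, `u'` separated**: the fibre is the class of `Z` times the admissible (or, if `k` and `u'` is
reached, invalid) count of `Z'`. -/
theorem card_fib_merged_sep (ω : E₁ → Bool) (hm : Z₁.Mg a₁ u ω) (hm' : ¬ Z₁.Mg a₁ u' ω) (c1 c2 k : Bool) :
    #(fib Z₁ u u' Z a Z' a' a₁ ω c1 c2 k) =
      #(cls Z' a' false false k (Z₁.Rd a₁ u' ω)) * #(cls Z a c1 c2 k (Z₁.Rd a₁ u ω)) := by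
  have hbc := not_Mg_exits_of_merged_sep Z₁ u u' a₁ ω hm hm'
  have e : fib Z₁ u u' Z a Z' a' a₁ ω c1 c2 k =
      cls Z' a' false false k (Z₁.Rd a₁ u' ω) ×ˢ cls Z a c1 c2 k (Z₁.Rd a₁ u ω) := by
    ext p
    rw [mem_fib, Finset.mem_product, mem_cls, mem_cls]
    simp only [fibCond, hm, hm', hbc, and_true, and_false, false_or, Bool.false_eq_true,
      false_implies, true_and]
    have h1 := Z'.not_mem_D_of_mem_D2 a' p.1
    have h2 := Z.not_mem_D_of_mem_D2 a p.2
    aesop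
  rw [e, Finset.card_product]

omit [Fintype E₁] [DecidableEq E₁] in
/-- **`u` separated, `u'` merged**: the fibre is the class of `Z'` times the admissible (or invalid) count of
`Z`. -/
theorem card_fib_sep_merged (ω : E₁ → Bool) (hm : ¬ Z₁.Mg a₁ u ω) (hm' : Z₁.Mg a₁ u' ω) (c1 c2 k : Bool) :
    #(fib Z₁ u u' Z a Z' a' a₁ ω c1 c2 k) =
      #(cls Z' a' c1 c2 k (Z₁.Rd a₁ u' ω)) * #(cls Z a false false k (Z₁.Rd a₁ u ω)) := by
  have hbc := not_Mg_exits_of_sep_merged Z₁ u u' a₁ ω hm hm'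
  have e : fib Z₁ u u' Z a Z' a' a₁ ω c1 c2 k =
      cls Z' a' c1 c2 k (Z₁.Rd a₁ u' ω) ×ˢ cls Z a false false k (Z₁.Rd a₁ u ω) := by
    ext p
    rw [mem_fib, Finset.mem_product, mem_cls, mem_cls]
    simp only [fibCond, hm, hm', hbc, and_true, and_false, false_or, or_false, Bool.false_eq_true,
      false_implies, true_and]
    have h1 := Z'.not_mem_D_of_mem_D2 a' p.1
    have h2 := Z.not_mem_D_of_mem_D2 a p.2
    aesop
  rw [e, Finset.card_product]

omit [Fintype E₁] [DecidableEq E₁] in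
/-- **Both exits separated, in different sub-zones**: the product of the two admissible (or invalid) counts. -/
theorem card_fib_sep_sep (ω : E₁ → Bool) (hm : ¬ Z₁.Mg a₁ u ω) (hm' : ¬ Z₁.Mg a₁ u' ω)
    (hbc : ¬ Z₁.Mg u u' ω) (c1 c2 k : Bool) :
    #(fib Z₁ u u' Z a Z' a' a₁ ω c1 c2 k) =
      #(cls Z' a' false false k (Z₁.Rd a₁ u' ω)) * #(cls Z a false false k (Z₁.Rd a₁ u ω)) := by
  have e : fib Z₁ u u' Z a Z' a' a₁ ω c1 c2 k =
      cls Z' a' false false k (Z₁.Rd a₁ u' ω) ×ˢ cls Z a false false k (Z₁.Rd a₁ u ω) := by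
    ext p
    rw [mem_fib, Finset.mem_product, mem_cls, mem_cls]
    simp only [fibCond, hm, hm', hbc, and_false, false_or, or_false, Bool.false_eq_true,
      false_implies, true_and, not_false_eq_true, implies_true]
    have h1 := Z'.not_mem_D_of_mem_D2 a' p.1
    have h2 := Z.not_mem_D_of_mem_D2 a p.2
    aesop
  rw [e, Finset.card_product]

omit [Fintype E₁] [DecidableEq E₁] in
/-- **Both exits separated in ONE sub-zone** (blue-connected): inclusion–exclusion — the fibre count plus
`L₀L₀'` is `L₁L₁' + L₂L₂'` (with the `k`-invalid counts when `k`); the class `(c1, c2)` does not matter. -/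
theorem card_fib_joint (ω : E₁ → Bool) (hm : ¬ Z₁.Mg a₁ u ω) (hm' : ¬ Z₁.Mg a₁ u' ω)
    (hbc : Z₁.Mg u u' ω) (c1 c2 k : Bool) :
    #(fib Z₁ u u' Z a Z' a' a₁ ω c1 c2 k) +
        #(cls Z' a' true true k (Z₁.Rd a₁ u' ω)) * #(cls Z a true true k (Z₁.Rd a₁ u ω)) =
      #(cls Z' a' false true k (Z₁.Rd a₁ u' ω)) * #(cls Z a false true k (Z₁.Rd a₁ u ω)) +
        #(cls Z' a' true false k (Z₁.Rd a₁ u' ω)) * #(cls Z a true false k (Z₁.Rd a₁ u ω)) := by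
  classical
  have e : fib Z₁ u u' Z a Z' a' a₁ ω c1 c2 k =
      cls Z' a' false true k (Z₁.Rd a₁ u' ω) ×ˢ cls Z a false true k (Z₁.Rd a₁ u ω) ∪
        cls Z' a' true false k (Z₁.Rd a₁ u' ω) ×ˢ cls Z a true false k (Z₁.Rd a₁ u ω) := by
    ext p
    rw [mem_fib, Finset.mem_union, Finset.mem_product, Finset.mem_product, mem_cls, mem_cls, mem_cls, mem_cls]
    simp only [fibCond, hm, hm', hbc, and_true, and_false, or_false, not_false_eq_true,
      implies_true, true_and, Bool.false_eq_true, false_implies, true_implies]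
    have h1 := Z'.not_mem_D_of_mem_D2 a' p.1
    have h2 := Z.not_mem_D_of_mem_D2 a p.2
    rcases Classical.em (a' ∈ Z'.D p.1) with hD' | hD' <;> rcases Classical.em (a ∈ Z.D p.2) with hD | hD <;>
      aesop
  have e2 : cls Z' a' false true k (Z₁.Rd a₁ u' ω) ×ˢ cls Z a false true k (Z₁.Rd a₁ u ω) ∩
        cls Z' a' true false k (Z₁.Rd a₁ u' ω) ×ˢ cls Z a true false k (Z₁.Rd a₁ u ω) =
      cls Z' a' true true k (Z₁.Rd a₁ u' ω) ×ˢ cls Z a true true k (Z₁.Rd a₁ u ω) := by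
    ext p
    rw [Finset.mem_inter, Finset.mem_product, Finset.mem_product, Finset.mem_product, mem_cls, mem_cls, mem_cls,
      mem_cls, mem_cls, mem_cls]
    simp only [Bool.false_eq_true, false_implies, true_implies, true_and]
    aesop
  rw [e, ← Finset.card_product, ← Finset.card_product, ← Finset.card_product, ← e2,
    Finset.card_union_add_card_inter]

end Counts

end TwoExit

end ZoneZ

end PercRepro
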